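import Mathlib
import HarnessLib
import Summits.NavierStokesRegularity.NavierStokesRegularity.Theorems.PoloidalWindowDoorPoloidalWindowRigidityHotHullCompactness
import Summits.NavierStokesRegularity.NavierStokesRegularity.Theorems.PoloidalWindowDoorPoloidalWindowRigidityLeafUniformPins
import Summits.NavierStokesRegularity.NavierStokesRegularity.Theorems.PoloidalWindowDoorLrcModEntireRidgeHullTools
import Summits.NavierStokesRegularity.NavierStokesRegularity.Theorems.SqueezeCycleExtremalElementExistsExtraction
import Summits.NavierStokesRegularity.NavierStokesRegularity.Theorems.SqueezeCycleExtremalElementExistsRegularity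
import Summits.NavierStokesRegularity.NavierStokesRegularity.Theorems.PoloidalWindowDoorLrcModEntireRidgeWebRecurrent

/-!
# Item `LrcModEntire` (stmt-NavierStokesRegularity-20428) / crux `PoloidalWindowRigidity` (19708) — RECURRENCE CONTROLS ALL JETS:
# in the Type-I ancient mild class, `C⁰`-closeness on a large slab forces `Cᵏ`-closeness of a slice on a ball (class compactness + KNSS smoothing), so the
# returns of a uniformly recurrent ridge web are close WITH ALL SPATIAL DERIVATIVES (DIRECTOR-NS #304 (A) default (b))

Seat ns-poloidal-K2-p2 g15 (`--supports stmt-NavierStokesRegularity-19708 --as helper`).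

* `jet_closeness_of_slab_closeness` — **C⁰ CONTROLS Cᵏ IN THE CLASS, UNIFORMLY.**  For every Type-I constant `C`, order `k`, time `t < 0`, radius `R` and `ε > 0`
  there are a slab index `N` and `η > 0` such that ANY two class-`C` profiles (Type-I decay, continuity, Oseen-mild identity, divergence-free — the four class clauses)
  which are `η`-close on the slab `[−(N+2), −(N+2)⁻¹] × B̄_{N+2}` have `k`-jets of their time-`t` slices `ε`-close on `B̄_R`.  PROOF: if not, pairs `(U_j, V_j)`
  `1/(j+1)`-close on slab `j` with `k`-jets `ε`-apart somewhere on `B̄_R`; KNSS extraction twice (`…exists_tendsto_of_isTypeIAncientMild_seq`) gives limits `U`, `V`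
  with `U = V` on `t < 0` (every point is eventually inside slab `j`); the class-uniform bounds of all orders (`…exists_norm_iteratedFDeriv_le_of_typeI`) upgrade the
  slice convergence to `C^∞` (port-2's (T0) `…RidgeHullTools.contDiffOn_and_tendsto_iteratedFDeriv_of_tendstoLocallyUniformlyOn`), uniformly on `B̄_R` — contradiction.
* `recurrent_jets` — for a class profile `U` and a curve `Γ` satisfying the UNIFORM RECURRENCE clause of `…RidgeWebRecurrent.exists_uniformlyRecurrent_ridgeWeb`
  (VERBATIM as a hypothesis; so this file does not import the recurrent-upgrade files and applies to ANY recurrent pair), the return times can be chosen so that,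
  besides the `C⁰` clauses on slab `n` and the branch clause on `[−(n+2), n+2]`, the `k`-jet of the slice `U t` is `ε`-close to its slide by `Γ σ'` on `B̄_R`:
  `‖Dᵏ(U t)(x + Γ σ') − Dᵏ(U t)(x)‖ < ε`.  (The slide `U(·, · + Γ σ')` is a class profile: `…LeafUniformPins.class_translate`; `iteratedFDeriv_comp_add_right`.)

WHAT THIS IS NOT: not a claim about Navier–Stokes regularity — a support for the (Q4) research cell of a door route (bears_on LADDER-NS N0, item 20428 / crux
19708; both OPEN; (Q4) OPEN; NS regularity NOT proved).
-/

noncomputable section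

-- the summit and its single sub-problem share the name (CONVENTIONS §1), as in every Theorems file
set_option linter.dupNamespace false

namespace Summit.NavierStokesRegularity.NavierStokesRegularity.Theorems.PoloidalWindowDoorLrcModEntireRidgeWebRecurrentJets

open Set Function Filter Topology Metric
open scoped InnerProductSpace RealInnerProductSpace NNReal ContDiff
open Literature.Analysis Literature.Analysis.FluidPDE Literature.Analysis.UnboundedOperators
open Summit.NavierStokesRegularity.NavierStokesRegularity.Theorems
open PoloidalWindowDoorPoloidalWindowRigidityHotHullCompactness PoloidalWindowDoorLrcModEntireRidgeHullTools
  PoloidalWindowDoorLrcModEntireRidgeWebRecurrent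

/-! ### Slabs -/

/-- Slabs increase with the index. -/
theorem slab_mono {n n' : ℕ} (h : n ≤ n') {s : ℝ} {x : EuclideanSpace ℝ (Fin 3)}
    (hs : s ∈ Icc (-((n : ℝ) + 2)) (-((n : ℝ) + 2)⁻¹)) (hx : x ∈ closedBall (0 : EuclideanSpace ℝ (Fin 3)) ((n : ℝ) + 2)) :
    s ∈ Icc (-((n' : ℝ) + 2)) (-((n' : ℝ) + 2)⁻¹) ∧ x ∈ closedBall (0 : EuclideanSpace ℝ (Fin 3)) ((n' : ℝ) + 2) := by
  have hnn : (n : ℝ) + 2 ≤ (n' : ℝ) + 2 := by have := Nat.cast_le (α := ℝ).2 h; linarith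
  have hn2 : (0 : ℝ) < (n : ℝ) + 2 := by positivity
  refine ⟨⟨by linarith [hs.1], hs.2.trans ?_⟩, closedBall_subset_closedBall hnn hx⟩
  rw [neg_le_neg_iff]
  exact inv_anti₀ hn2 hnn

/-! ### `C⁰` controls `Cᵏ` in the class -/

/-- **C⁰-closeness on a large slab forces Cᵏ-closeness of a slice on a ball, uniformly over the class.**  See the module docstring. -/
theorem jet_closeness_of_slab_closeness (C : ℝ) (k : ℕ) {t : ℝ} (ht : t < 0) (R ε : ℝ) (hε : 0 < ε) :
    ∃ (N : ℕ) (η : ℝ), 0 < η ∧ ∀ U V : ℝ → EuclideanSpace ℝ (Fin 3) → EuclideanSpace ℝ (Fin 3),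
      HasTypeITimeDecay C U → ContinuousOn (uncurry U) (Iio (0 : ℝ) ×ˢ univ) →
      (∀ s t : ℝ, s < t → t < 0 → ∀ x, U t x = heatExtension (U s) (t - s) x - oseenDuhamel 1 s U U t x) →
      (∀ t < 0, VectorCalculus.IsDivFree (U t)) →
      HasTypeITimeDecay C V → ContinuousOn (uncurry V) (Iio (0 : ℝ) ×ˢ univ) →
      (∀ s t : ℝ, s < t → t < 0 → ∀ x, V t x = heatExtension (V s) (t - s) x - oseenDuhamel 1 s V V t x) →
      (∀ t < 0, VectorCalculus.IsDivFree (V t)) →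
      (∀ s ∈ Icc (-((N : ℝ) + 2)) (-((N : ℝ) + 2)⁻¹), ∀ x ∈ closedBall (0 : EuclideanSpace ℝ (Fin 3)) ((N : ℝ) + 2), dist (U s x) (V s x) < η) →
      ∀ x ∈ closedBall (0 : EuclideanSpace ℝ (Fin 3)) R, ‖iteratedFDeriv ℝ k (U t) x - iteratedFDeriv ℝ k (V t) x‖ < ε := by
  classical
  by_contra hcon
  push Not at hcon
  -- bad pairs: `1/(j+1)`-close on slab `j`, `k`-jets `ε`-apart somewhere on `B̄_R`
  have hch : ∀ j : ℕ, ∃ U V : ℝ → EuclideanSpace ℝ (Fin 3) → EuclideanSpace ℝ (Fin 3), IsTypeIAncientMild C U ∧ IsTypeIAncientMild C V ∧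
      (∀ s ∈ Icc (-((j : ℝ) + 2)) (-((j : ℝ) + 2)⁻¹), ∀ x ∈ closedBall (0 : EuclideanSpace ℝ (Fin 3)) ((j : ℝ) + 2), dist (U s x) (V s x) < 1 / ((j : ℝ) + 1)) ∧
      ∃ x ∈ closedBall (0 : EuclideanSpace ℝ (Fin 3)) R, ε ≤ ‖iteratedFDeriv ℝ k (U t) x - iteratedFDeriv ℝ k (V t) x‖ := by
    intro j
    obtain ⟨U, V, hU1, hU2, hU3, hU4, hV1, hV2, hV3, hV4, hclose, x, hx, hfar⟩ := hcon j (1 / ((j : ℝ) + 1)) (by positivity)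
    exact ⟨U, V, PoloidalWindowDoorPoloidalWindowRigidityWindow.isTypeIAncientMild_of_class hU1 hU2 hU3 hU4,
      PoloidalWindowDoorPoloidalWindowRigidityWindow.isTypeIAncientMild_of_class hV1 hV2 hV3 hV4, hclose, x, hx, hfar⟩
  choose Us Vs hUs hVs hclose xs hxs hfar using hch
  -- extraction, twice
  obtain ⟨φ₁, hφ₁, U, hU, hptU, -, htluU, -⟩ := exists_tendsto_of_isTypeIAncientMild_seq C hUs
  obtain ⟨φ₂, hφ₂, V, hV, hptV, -, htluV, -⟩ := exists_tendsto_of_isTypeIAncientMild_seq C (fun j => hVs (φ₁ j))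
  set ψ : ℕ → ℕ := φ₁ ∘ φ₂ with hψ
  have hψm : StrictMono ψ := hφ₁.comp hφ₂
  have hptU' : ∀ s < 0, ∀ x, Tendsto (fun j => Us (ψ j) s x) atTop (𝓝 (U s x)) := fun s hs x => (hptU s hs x).comp hφ₂.tendsto_atTop
  have htluU' : ∀ s < 0, TendstoLocallyUniformly (fun j => Us (ψ j) s) (U s) atTop := fun s hs => by
    intro u hu x
    obtain ⟨w, hw, hev⟩ := htluU s hs u hu x
    exact ⟨w, hw, hφ₂.tendsto_atTop.eventually hev⟩
  -- the limits agree on `t < 0`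
  have hUV : ∀ s < 0, U s = V s := by
    intro s hs
    funext x
    have hd : Tendsto (fun j => dist (Us (ψ j) s x) (Vs (ψ j) s x)) atTop (𝓝 0) := by
      rw [Metric.tendsto_nhds]
      intro δ hδ
      obtain ⟨m₀, hm₀⟩ := exists_nat_gt (1 / δ)
      filter_upwards [(hψm.tendsto_atTop).eventually (eventually_mem_slab hs x), (hψm.tendsto_atTop).eventually (eventually_ge_atTop m₀)] with j hj hjm
      have h := hclose (ψ j) s hj.1 x hj.2
      have hsmall : 1 / ((ψ j : ℝ) + 1) < δ := by
        have hmj : (m₀ : ℝ) ≤ (ψ j : ℝ) := Nat.cast_le.2 hjm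
        rw [div_lt_iff₀ (by positivity)]
        rw [div_lt_iff₀ hδ] at hm₀
        nlinarith
      rw [Real.dist_eq, sub_zero, abs_of_nonneg dist_nonneg]
      exact h.trans hsmall
    have hd' : Tendsto (fun j => dist (Us (ψ j) s x) (Vs (ψ j) s x)) atTop (𝓝 (dist (U s x) (V s x))) :=
      (hptU' s hs x).dist (hptV s hs x)
    exact dist_eq_zero.1 (tendsto_nhds_unique hd' hd)
  -- class-uniform bounds of all orders at time `t` ⇒ `C^∞` convergence of the slices (T0)
  have hbounds : ∀ i : ℕ, ∃ Λ : ℝ, ∀ (W : ℝ → EuclideanSpace ℝ (Fin 3) → EuclideanSpace ℝ (Fin 3)), IsTypeIAncientMild C W → ∀ x, ‖iteratedFDeriv ℝ i (W t) x‖ ≤ Λ := by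
    intro i
    obtain ⟨K, hK⟩ := exists_norm_iteratedFDeriv_le_of_typeI C i (a := t - 2) (b := t / 2) (δ := 1) (by linarith) (by linarith) one_pos
    refine ⟨K, fun W hW x => hK hW.continuousOn_uncurry (fun s hs => hW.isWeaklyDivFree hs) (fun s s' hss' hs' y => hW.mild_eq_heatExtension hss' hs' y)
      hW.hasTypeITimeDecay t ⟨by linarith, by linarith⟩ x⟩
  have hT0 : ∀ (Ws : ℕ → ℝ → EuclideanSpace ℝ (Fin 3) → EuclideanSpace ℝ (Fin 3)) (W : ℝ → EuclideanSpace ℝ (Fin 3) → EuclideanSpace ℝ (Fin 3)), (∀ j, IsTypeIAncientMild C (Ws j)) →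
      TendstoLocallyUniformly (fun j => Ws j t) (W t) atTop →
      TendstoUniformlyOn (fun j => iteratedFDeriv ℝ k (Ws j t)) (iteratedFDeriv ℝ k (W t)) atTop (closedBall (0 : EuclideanSpace ℝ (Fin 3)) R) := by
    intro Ws W hWs hconv
    have hf : ∀ j, ContDiffOn ℝ ∞ (Ws j t) univ := fun j => ((hWs j).analyticOnNhd_slice_univ ht).contDiff.contDiffOn
    have hb : ∀ (i : ℕ), ∀ K ⊆ (univ : Set (EuclideanSpace ℝ (Fin 3))), IsCompact K → ∃ Λ : ℝ, ∀ j, ∀ z ∈ K, ‖iteratedFDeriv ℝ i (Ws j t) z‖ ≤ Λ := by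
      intro i K _ _
      obtain ⟨Λ, hΛ⟩ := hbounds i
      exact ⟨Λ, fun j z _ => hΛ _ (hWs j) z⟩
    obtain ⟨-, hlim⟩ := contDiffOn_and_tendsto_iteratedFDeriv_of_tendstoLocallyUniformlyOn isOpen_univ hf hb
      (tendstoLocallyUniformlyOn_univ.2 hconv)
    exact (tendstoLocallyUniformlyOn_iff_forall_isCompact isOpen_univ).1 (hlim k) _ (subset_univ _) (isCompact_closedBall _ _)
  have hJU := hT0 (fun j => Us (ψ j)) U (fun j => hUs (ψ j)) (htluU' t ht)
  have hJV := hT0 (fun j => Vs (φ₁ (φ₂ j))) V (fun j => hVs (φ₁ (φ₂ j))) (htluV t ht)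
  have hUVt : iteratedFDeriv ℝ k (U t) = iteratedFDeriv ℝ k (V t) := by rw [hUV t ht]
  -- contradiction at the bad points
  have h1 := Metric.tendstoUniformlyOn_iff.1 hJU (ε / 2) (half_pos hε)
  have h2 := Metric.tendstoUniformlyOn_iff.1 hJV (ε / 2) (half_pos hε)
  obtain ⟨j, hj1, hj2⟩ := (h1.and h2).exists
  have hx := hxs (ψ j)
  have ha := hj1 (xs (ψ j)) hx
  have hb := hj2 (xs (ψ j)) hx
  rw [hUVt] at ha
  have hlt : ‖iteratedFDeriv ℝ k (Us (ψ j) t) (xs (ψ j)) - iteratedFDeriv ℝ k (Vs (ψ j) t) (xs (ψ j))‖ < ε := by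
    rw [← dist_eq_norm]
    calc dist (iteratedFDeriv ℝ k (Us (ψ j) t) (xs (ψ j))) (iteratedFDeriv ℝ k (Vs (ψ j) t) (xs (ψ j)))
        ≤ dist (iteratedFDeriv ℝ k (Us (ψ j) t) (xs (ψ j))) (iteratedFDeriv ℝ k (V t) (xs (ψ j))) +
            dist (iteratedFDeriv ℝ k (V t) (xs (ψ j))) (iteratedFDeriv ℝ k (Vs (ψ j) t) (xs (ψ j))) := dist_triangle _ _ _
      _ < ε / 2 + ε / 2 := by
          refine add_lt_add ?_ hb
          rw [dist_comm]; exact ha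
      _ = ε := add_halves ε
  exact absurd (hfar (ψ j)) (not_le.2 hlt)

/-! ### The returns of a uniformly recurrent pair are close with all jets -/

/-- **Recurrence controls all jets.**  See the module docstring; the recurrence clause is the one of `…RidgeWebRecurrent.exists_uniformlyRecurrent_ridgeWeb`, VERBATIM. -/
theorem recurrent_jets {C : ℝ} {U : ℝ → EuclideanSpace ℝ (Fin 3) → EuclideanSpace ℝ (Fin 3)} {Γ : ℝ → EuclideanSpace ℝ (Fin 3)}
    (hrate : HasTypeITimeDecay C U) (hcont : ContinuousOn (uncurry U) (Iio (0 : ℝ) ×ˢ univ))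
    (hmild : ∀ s t : ℝ, s < t → t < 0 → ∀ x, U t x = heatExtension (U s) (t - s) x - oseenDuhamel 1 s U U t x)
    (hdiv : ∀ t < 0, VectorCalculus.IsDivFree (U t))
    (hrec : (∀ ε : ℝ, 0 < ε → ∀ n : ℕ, ∃ L : ℝ, 0 < L ∧ ∀ a : ℝ, ∃ σ' ∈ Icc a (a + L),
        (∀ t ∈ Icc (-((n : ℝ) + 2)) (-((n : ℝ) + 2)⁻¹), ∀ x ∈ closedBall (0 : EuclideanSpace ℝ (Fin 3)) ((n : ℝ) + 2),
          dist (U t (x + Γ σ')) (U t x) < ε) ∧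
        (∀ s ∈ Icc (-((n : ℝ) + 2)) ((n : ℝ) + 2), dist (Γ (s + σ') - Γ σ') (Γ s) < ε)))
    (k : ℕ) {t : ℝ} (ht : t < 0) (R ε : ℝ) (hε : 0 < ε) (n : ℕ) :
    ∃ L : ℝ, 0 < L ∧ ∀ a : ℝ, ∃ σ' ∈ Icc a (a + L),
      (∀ s ∈ Icc (-((n : ℝ) + 2)) (-((n : ℝ) + 2)⁻¹), ∀ x ∈ closedBall (0 : EuclideanSpace ℝ (Fin 3)) ((n : ℝ) + 2), dist (U s (x + Γ σ')) (U s x) < ε) ∧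
      (∀ s ∈ Icc (-((n : ℝ) + 2)) ((n : ℝ) + 2), dist (Γ (s + σ') - Γ σ') (Γ s) < ε) ∧
      (∀ x ∈ closedBall (0 : EuclideanSpace ℝ (Fin 3)) R, ‖iteratedFDeriv ℝ k (U t) (x + Γ σ') - iteratedFDeriv ℝ k (U t) x‖ < ε) := by
  obtain ⟨N, η, hη, hJ⟩ := jet_closeness_of_slab_closeness C k ht R ε hε
  obtain ⟨L, hL, hwin⟩ := hrec (min η ε) (lt_min hη hε) (max N n)
  refine ⟨L, hL, fun a => ?_⟩
  obtain ⟨σ', hσ', h1, h2⟩ := hwin a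
  have hnN : n ≤ max N n := le_max_right _ _
  have hNN : N ≤ max N n := le_max_left _ _
  refine ⟨σ', hσ', fun s hs x hx => ?_, fun s hs => ?_, fun x hx => ?_⟩
  · obtain ⟨hs', hx'⟩ := slab_mono hnN hs hx
    exact (h1 s hs' x hx').trans_le (min_le_right _ _)
  · have hmn : (n : ℝ) + 2 ≤ ((max N n : ℕ) : ℝ) + 2 := by have := Nat.cast_le (α := ℝ).2 hnN; linarith
    exact (h2 s ⟨by linarith [hs.1], hs.2.trans hmn⟩).trans_le (min_le_right _ _)
  · -- the slide is a class profile, `η`-close to `U` on slab `N`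
    obtain ⟨hrate', hcont', hmild'⟩ := PoloidalWindowDoorPoloidalWindowRigidityLeafUniformPins.class_translate hrate hcont hmild (Γ σ')
    have hdiv' : ∀ t < 0, VectorCalculus.IsDivFree ((fun t x => U t (x + Γ σ')) t) := fun t ht' => isDivFree_translate_arg (hdiv t ht') (Γ σ')
    have hclose : ∀ s ∈ Icc (-((N : ℝ) + 2)) (-((N : ℝ) + 2)⁻¹), ∀ x ∈ closedBall (0 : EuclideanSpace ℝ (Fin 3)) ((N : ℝ) + 2),
        dist ((fun t x => U t (x + Γ σ')) s x) (U s x) < η := fun s hs x hx => by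
      obtain ⟨hs', hx'⟩ := slab_mono hNN hs hx
      exact (h1 s hs' x hx').trans_le (min_le_left _ _)
    have h := hJ (fun t x => U t (x + Γ σ')) U hrate' hcont' hmild' hdiv' hrate hcont hmild hdiv hclose x hx
    have e : iteratedFDeriv ℝ k ((fun t x => U t (x + Γ σ')) t) x = iteratedFDeriv ℝ k (U t) (x + Γ σ') :=
      iteratedFDeriv_comp_add_right k (Γ σ') x
    rw [e] at h
    exact h

end Summit.NavierStokesRegularity.NavierStokesRegularity.Theorems.PoloidalWindowDoorLrcModEntireRidgeWebRecurrentJets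

end
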